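import Literature.MathematicalPhysics.QuantumFieldTheory.Balaban1983to89.B9Eq349ConjugatedDPChainLettersTower
import Literature.MathematicalPhysics.QuantumFieldTheory.Balaban1983to89.B9Eq319QprimeTowerLipschitzL2TwoBackgroundsChain

/-!
# `Balaban1983to89.B9Eq349ConjugatedQprimeTowerTwoBackgrounds` — T. Bałaban, *Propagators for lattice gauge theories in a background field*, Commun.
# Math. Phys. **99** (1985) 389–434 [Balaban1985BackgroundPropagators] (3.19) p. 393, (3.21)∕(3.25) p. 394, (3.49) p. 399, (3.101)–(3.103) p. 414:
# **THE CONJUGATED TWO-BACKGROUND LETTERS OF THE COMPOSITE SITE AVERAGING `Q̃′_k`** — under the Combes–Thomas conjugation `S = e^{κχ}` (fine torus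
# `T_{L^{n+1}m}`), `S_G = e^{κχ′}` (unit lattice), for TWO backgrounds `U`, `V`:
# **`‖S_G Q̃′_k(V) S⁻¹ f − S_G Q̃′_k(U) S⁻¹ f‖ ≤ e^{‖κ‖ℓ′}·δ_{Q′}·‖f‖`** at `κ`, at `−κ̄` (the adjoint multipliers), and the adjoint reading
# `‖S Q̃′_k(V)† S_G⁻¹ g − S Q̃′_k(U)† S_G⁻¹ g‖ ≤ e^{‖κ‖ℓ′}·δ_{Q′}·‖g‖`, where `δ_{Q′}` is ANY unconjugated two-background letter
# `‖Q̃′_k(V) s − Q̃′_k(U) s‖ ≤ δ_{Q′}‖s‖` (§1, displayed) — in particular ne9-leaf-02's chain letter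
# `B9Eq319QprimeTowerLipschitzL2TwoBackgroundsChain.norm_QtildeTower_sub_QtildeTower_le` (§2, discharged: `δ_{Q′} = P_ε·(T_{ε,δ} − 1)·√(c₁∕(c₀L^{(n+1)d}))`).
# NO window, NO transport factor: by BIG-BLOCK LOCALITY (ne9-leaf-03's `B9Eq349ConjugatedDPChainLettersTower` §0) `S_G Q̃′_k(X) S⁻¹ = Q̃′_k(X) ∘ (τ·)`
# EXACTLY for EVERY background `X`, with ONE phase `τ(x) = e^{κ(χ′(Πx) − χ(x))}`, `|τ| ≤ e^{‖κ‖ℓ′}` — so the conjugated difference IS the plain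
# difference evaluated at `τ·f`

statement-level skeleton of published theorems with citation tags; proofs where landed; nothing here is a claim about the Yang–Mills mass gap

PDF held: `paper:balaban1985-cmp99-background-propagators` (journal page = PDF page + 388); pp. 393–394, 399, 414 read.

CITATION HEADER (lean-in-tree rule 2026-08-18).  Audit cell `pub-balaban`, sub-cell `t4`, NE9 crux team (2): LEAF PROVER 01 (`b2b-balaban-t4-ne9-formalise-leaf-01`
gen 90), I-8 = the FIRST brick of the last displayed conjugated two-background letter `δ_R` of the N52 road (α) END (ne9-leaf-04 g81's
`LOCATED-deltaQ-deltaR.md` § «δ_R — plan (M+): the (PDC) chain run on DIFFERENCES with the conjugated two-background `Q′`-letters … and `G′`-letters»):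
the `Q′`-letters.  WHY CHEAP: the one-background (I4) letter of the composite averaging (ne9-leaf-03 g74, `norm_QpTower_sub_le`) rests on an EXACT
commutation identity that does not see the background; at two backgrounds the same identity turns the conjugated difference into the unconjugated one
(ne9-leaf-02's `ℓ²` tower letter) on a phase-multiplied vector.  TEMPLATES CREDITED: `B9Eq349ConjugatedDPChainLettersTower.norm_QpTower_sub_le` ∕
`norm_QmTower_sub_le` ∕ `norm_QpTower'_sub_le` (statement shapes and the `−κ̄` ∕ pairing devices verbatim), `B9Eq311PointwiseMultipliers`
(`norm_apply_le_of_pointwise`, `equiv_adjoint_of_pointwise`), `B9Eq324ConjugatedFormDifference.norm_le_of_inner_eq_inner` (ne9-leaf-04).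

WHAT IS PROVED (sorry-free; 0 `def`; [folklore] Hilbert-space algebra of pointwise multipliers; nothing of [B9] asserted as printed).
* §1 `conj_QtildeTower_apply_eq` — `S_G Q̃′_k(X) S⁻¹ f = Q̃′_k(X) u` for EVERY background `X`, whenever `u = τ·f` pointwise; `norm_phaseVec_le` —
  `‖u‖ ≤ e^{‖κ‖ℓ′}‖f‖` under the coarse reading `|χ′(y) − χ(x)| ≤ ℓ′` on the big block of `y`;
  **`norm_QpTower_sub_QpTower_le`** (at `κ`), **`norm_QmTower_sub_QmTower_le`** (at `−κ̄`: `(S_G⁻¹)† Q̃′_k(·) S†`), **`norm_QpTower'_sub_QpTower'_le`**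
  (the adjoints `S Q̃′_k(·)† S_G⁻¹`): each `≤ e^{‖κ‖ℓ′}·δ_{Q′}·‖·‖` from the displayed letter `δ_{Q′}`; `exp_norm_mul_le_three` — under the window
  `‖κ‖ℓ′ ≤ 1` the factor `e^{‖κ‖ℓ′}` is `≤ 3`.
* §2 `norm_QpTower_sub_QpTower_le_of_levels`, `norm_QmTower_sub_QmTower_le_of_levels`, `norm_QpTower'_sub_QpTower'_le_of_levels` — §1 with `δ_{Q′}`
  DISCHARGED by ne9-leaf-02's `norm_QtildeTower_sub_QtildeTower_le`: the level averages `Ū^j`, `V̄^j` `U1`-valued, `ε_j`-small, `δ_j`-close ⟹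
  `δ_{Q′} = Π_{j≤n}(1+2M_φM_φ′ε_j)^{d(L−1)}·(Π_{j≤n}(1 + d(L−1)·2M_φM_φ′δ_j·(1+2M_φM_φ′ε_j)^{d(L−1)}) − 1)·√(c₁∕(c₀(L^{n+1})^d))` (`= 1` along (3.16)),
  LINEAR in `max δ_j` at small closeness (their `norm_QtildeTower_sub_QtildeTower_le_linear` gives the geometric-profile reading; not restated).
MODEL ∕ DECLARED READINGS.  `S`, `S⁻¹`, `S_G`, `S_G⁻¹` are ANY linear maps acting pointwise as `e^{±κχ}`, `e^{±κχ′}` (the route's Combes–Thomas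
multipliers, [B9] (3.49)'s `exp(−δ₀d(y,y′))` being print's random-walk currency — NOT asserted); `χ′` reads `χ` on big blocks within `ℓ′`.
HONEST SCOPE.  [folklore]; ONE brick (the `Q′`-letters) of the located `δ_R` plan — the `G′`-letters, the inverse `(Q̃′G′²Q̃′†)⁻¹` on differences and the
chain assembly are NOT here; no rate ∕ window ∕ number evaluated; NOT NE9; «NE9 ⇐ the named binders»; NE9 NOT PRINTED ∕ NOT PROVED; NOT summit progress
(cell pub-balaban: row NE9 WALLED ON A MODEL (O-NE9-1; #5 UNRULED); spine PROVED 0∕9; rung (B)+1 finite T⁴ — NOT infinite volume, NOT mass gap, NOT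
BetaPertH, NOT Clay; HONEST DEPENDENCY: continuum YM on T⁴ ⇐ BetaPertH ∧ nine spine estimates (0/9 proved); BetaPertH ⇐ (D1) ∧ (D4) ∧ CAP+tail; G-an2-4
gates asym, D1 and NE2/3/4).  NEW file; nothing modified.  Net new unproved facts: 0.
-/

noncomputable section

open scoped InnerProductSpace ComplexConjugate

namespace Literature.MathematicalPhysics.QuantumFieldTheory.Balaban1983to89.B9Eq349ConjugatedQprimeTowerTwoBackgrounds

open B4Sect5Torus (TSite)
open B9SectCLatticeCarrier (Bond)
open B9Eq311L2Pairing (WL2)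
open B9Eq319QprimeTorus (blockCoord)
open B9Eq315QTower (towerP UlevOf)
open B9Eq316TowerFlatIsOneStep (siteCast towerP_eq_fineP_pow)
open B7Prop1Explicit (U1)
open B11Eq103H1Complex (SiteL2K)
open B9Eq326OperatorTower (QprimeTowerW)
open B9Eq349ConjugatedDPChainLettersTower (equiv_QtildeTower_of_bigBlockConst)
open B9Eq319QprimeTowerLipschitzL2TwoBackgroundsChain (norm_QtildeTower_sub_QtildeTower_le)

/-! ## §1 The phase device at two backgrounds: the conjugated difference is the plain difference at `τ·f` -/

section Letters

variable {d : ℕ} {L : ℕ} [NeZero L] {m : Fin d → ℕ} [∀ i, NeZero (m i)] {n : ℕ}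
  {𝔸 : Type*} [NormedRing 𝔸] [NormedAlgebra ℂ 𝔸] [CompleteSpace 𝔸]
  {W : Type*} [NormedAddCommGroup W] [InnerProductSpace ℂ W] [FiniteDimensional ℂ W] {φ : W ≃ₗ[ℂ] 𝔸}
  {c₀ : ℝ} [Fact (0 < c₀)] {U V : Bond d (towerP L m (n + 1)) → 𝔸ˣ} {c₁ : ℝ} [Fact (0 < c₁)]
  {κ : ℂ} {ℓ' : ℝ} {χ : TSite d (towerP L m (n + 1)) → ℝ} {χ' : TSite d m → ℝ}

omit [FiniteDimensional ℂ W] [Fact (0 < c₀)] [Fact (0 < c₁)] in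
/-- **`S_G Q̃′_k(X) S⁻¹ = Q̃′_k(X) ∘ (τ·)` FOR EVERY BACKGROUND `X`**: if `S⁻¹` acts as `e^{−κχ}`, `S_G` as `e^{κχ′}` and `u = τ·f` pointwise with the phase
`τ(x) = e^{κχ′(Πx)}·e^{−κχ(x)}`, then `S_G(Q̃′_k(X)(S⁻¹f)) = Q̃′_k(X)u` — big-block locality (`equiv_QtildeTower_of_bigBlockConst`). [folklore]
[cite: Balaban1985BackgroundPropagators, (3.19) p.393, (3.49) p.399, (3.101) p.414] -/
theorem conj_QtildeTower_apply_eq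
    {Sinv : SiteL2K ℂ d (towerP L m (n + 1)) c₀ W →ₗ[ℂ] SiteL2K ℂ d (towerP L m (n + 1)) c₀ W}
    (hSinv : ∀ (f : SiteL2K ℂ d (towerP L m (n + 1)) c₀ W) (x : TSite d (towerP L m (n + 1))),
      WL2.equiv ℂ (fun _ : TSite d (towerP L m (n + 1)) => c₀) W (Sinv f) x =
        Complex.exp (-(κ * (χ x : ℂ))) • WL2.equiv ℂ (fun _ : TSite d (towerP L m (n + 1)) => c₀) W f x)
    {SG : SiteL2K ℂ d m c₁ W →ₗ[ℂ] SiteL2K ℂ d m c₁ W}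
    (hSG : ∀ (g : SiteL2K ℂ d m c₁ W) (y : TSite d m),
      WL2.equiv ℂ (fun _ : TSite d m => c₁) W (SG g) y = Complex.exp (κ * (χ' y : ℂ)) • WL2.equiv ℂ (fun _ : TSite d m => c₁) W g y)
    (X : Bond d (towerP L m (n + 1)) → 𝔸ˣ) {f u : SiteL2K ℂ d (towerP L m (n + 1)) c₀ W}
    (hu : ∀ x : TSite d (towerP L m (n + 1)), WL2.equiv ℂ (fun _ : TSite d (towerP L m (n + 1)) => c₀) W u x =
      (Complex.exp (κ * (χ' (blockCoord (L ^ (n + 1)) m (siteCast (towerP_eq_fineP_pow L m (n + 1)) x)) : ℂ)) *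
        Complex.exp (-(κ * (χ x : ℂ)))) • WL2.equiv ℂ (fun _ : TSite d (towerP L m (n + 1)) => c₀) W f x) :
    (SG ∘ₗ ((WL2.linearEquiv ℂ ℂ (fun _ : TSite d m => c₁)).symm.toLinearMap ∘ₗ QprimeTowerW L m n φ X (c₀ := c₀)) ∘ₗ Sinv) f =
      ((WL2.linearEquiv ℂ ℂ (fun _ : TSite d m => c₁)).symm.toLinearMap ∘ₗ QprimeTowerW L m n φ X (c₀ := c₀)) u := by
  apply (WL2.equiv ℂ (fun _ : TSite d m => c₁) W).injective
  funext y
  rw [LinearMap.comp_apply, LinearMap.comp_apply, hSG]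
  exact (equiv_QtildeTower_of_bigBlockConst (φ := φ) (U := X) (c₁ := c₁)
    (σ := fun x => Complex.exp (κ * (χ' (blockCoord (L ^ (n + 1)) m (siteCast (towerP_eq_fineP_pow L m (n + 1)) x)) : ℂ)))
    (g := fun y => Complex.exp (κ * (χ' y : ℂ))) (fun x y hxy => by simp only [hxy]) (l := Sinv f) (l' := u)
    (fun x => by rw [hu, hSinv, mul_smul]) y).symm

omit [NeZero L] [∀ i, NeZero (m i)] [FiniteDimensional ℂ W] in
/-- **THE PHASE COSTS `e^{‖κ‖ℓ′}`**: `u = τ·f` pointwise, `|χ′(y) − χ(x)| ≤ ℓ′` on the big block of `y` ⟹ `‖u‖ ≤ e^{‖κ‖ℓ′}·‖f‖`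
(`|e^{z}| = e^{Re z} ≤ e^{|z|}`; `B9Eq311PointwiseMultipliers.norm_apply_le_of_pointwise`). [folklore]
[cite: Balaban1985BackgroundPropagators, (3.49) p.399, (3.101)–(3.103) p.414] -/
theorem norm_phaseVec_le
    (hχ' : ∀ (y : TSite d m) (x : TSite d (towerP L m (n + 1))),
      blockCoord (L ^ (n + 1)) m (siteCast (towerP_eq_fineP_pow L m (n + 1)) x) = y → |χ' y - χ x| ≤ ℓ')
    {f u : SiteL2K ℂ d (towerP L m (n + 1)) c₀ W}
    (hu : ∀ x : TSite d (towerP L m (n + 1)), WL2.equiv ℂ (fun _ : TSite d (towerP L m (n + 1)) => c₀) W u x =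
      (Complex.exp (κ * (χ' (blockCoord (L ^ (n + 1)) m (siteCast (towerP_eq_fineP_pow L m (n + 1)) x)) : ℂ)) *
        Complex.exp (-(κ * (χ x : ℂ)))) • WL2.equiv ℂ (fun _ : TSite d (towerP L m (n + 1)) => c₀) W f x) :
    ‖u‖ ≤ Real.exp (‖κ‖ * ℓ') * ‖f‖ := by
  let bb : TSite d (towerP L m (n + 1)) → TSite d m := fun x => blockCoord (L ^ (n + 1)) m (siteCast (towerP_eq_fineP_pow L m (n + 1)) x)
  let τ : TSite d (towerP L m (n + 1)) → ℂ := fun x => Complex.exp (κ * (χ' (bb x) : ℂ)) * Complex.exp (-(κ * (χ x : ℂ)))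
  let T : SiteL2K ℂ d (towerP L m (n + 1)) c₀ W → SiteL2K ℂ d (towerP L m (n + 1)) c₀ W := fun l =>
    (WL2.equiv ℂ (fun _ : TSite d (towerP L m (n + 1)) => c₀) W).symm fun x =>
      τ x • WL2.equiv ℂ (fun _ : TSite d (towerP L m (n + 1)) => c₀) W l x
  have huT : u = T f :=
    (WL2.equiv ℂ (fun _ : TSite d (towerP L m (n + 1)) => c₀) W).injective (funext fun x => by
      simp only [T, τ, bb, Equiv.apply_symm_apply, hu])
  have hτ : ∀ x, ‖τ x‖ ≤ Real.exp (‖κ‖ * ℓ') := by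
    intro x
    have hz : ‖κ * (χ' (bb x) : ℂ) + -(κ * (χ x : ℂ))‖ ≤ ‖κ‖ * ℓ' := by
      rw [← sub_eq_add_neg, ← mul_sub, norm_mul, ← Complex.ofReal_sub, Complex.norm_real, Real.norm_eq_abs]
      exact mul_le_mul_of_nonneg_left (hχ' (bb x) x rfl) (norm_nonneg κ)
    calc ‖τ x‖ = ‖Complex.exp (κ * (χ' (bb x) : ℂ) + -(κ * (χ x : ℂ)))‖ := by rw [Complex.exp_add]
      _ = Real.exp (κ * (χ' (bb x) : ℂ) + -(κ * (χ x : ℂ))).re := Complex.norm_exp _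
      _ ≤ Real.exp (‖κ‖ * ℓ') := Real.exp_le_exp.2 ((Complex.re_le_norm _).trans hz)
  rw [huT]
  exact B9Eq311PointwiseMultipliers.norm_apply_le_of_pointwise (S := T) (σ := τ) (fun l x => by simp only [T, Equiv.apply_symm_apply])
    (Real.exp_pos _).le hτ f

/-- Under the window `‖κ‖ℓ′ ≤ 1` the phase factor is `≤ 3` (`e < 3`). [folklore] [cite: Balaban1985BackgroundPropagators, (3.49) p.399] -/
theorem exp_norm_mul_le_three (hwin' : ‖κ‖ * ℓ' ≤ 1) : Real.exp (‖κ‖ * ℓ') ≤ 3 :=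
  (Real.exp_le_exp.2 hwin').trans (by have := Real.exp_one_lt_d9; norm_num at this ⊢; linarith)

omit [FiniteDimensional ℂ W] in
/-- **THE CONJUGATED TWO-BACKGROUND LETTER OF THE COMPOSITE AVERAGING AT `κ`**: for ANY linear `S_G`, `S⁻¹` acting pointwise as `e^{κχ′(y)}` on the
unit lattice and `e^{−κχ(x)}` on the fine torus `T_{L^{n+1}m}`, a coarse reading `|χ′(y) − χ(x)| ≤ ℓ′` on the big block over `y` and an unconjugated
two-background letter `‖Q̃′_k(V)s − Q̃′_k(U)s‖ ≤ δ_{Q′}‖s‖`: **`‖S_G Q̃′_k(V) S⁻¹ f − S_G Q̃′_k(U) S⁻¹ f‖ ≤ e^{‖κ‖ℓ′}·δ_{Q′}·‖f‖`** — NO window, NO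
transport factor: both conjugates are `Q̃′_k(·)` at the SAME phase-multiplied vector `τ·f` (`conj_QtildeTower_apply_eq`). [folklore]
[cite: Balaban1985BackgroundPropagators, (3.19) p.393, (3.49) p.399, (3.101)–(3.103) p.414] -/
theorem norm_QpTower_sub_QpTower_le
    (hχ' : ∀ (y : TSite d m) (x : TSite d (towerP L m (n + 1))),
      blockCoord (L ^ (n + 1)) m (siteCast (towerP_eq_fineP_pow L m (n + 1)) x) = y → |χ' y - χ x| ≤ ℓ')
    {δQ : ℝ} (hδQ : 0 ≤ δQ)
    (hLip : ∀ s, ‖((WL2.linearEquiv ℂ ℂ (fun _ : TSite d m => c₁)).symm.toLinearMap ∘ₗ QprimeTowerW L m n φ V (c₀ := c₀)) s -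
      ((WL2.linearEquiv ℂ ℂ (fun _ : TSite d m => c₁)).symm.toLinearMap ∘ₗ QprimeTowerW L m n φ U (c₀ := c₀)) s‖ ≤ δQ * ‖s‖)
    {Sinv : SiteL2K ℂ d (towerP L m (n + 1)) c₀ W →ₗ[ℂ] SiteL2K ℂ d (towerP L m (n + 1)) c₀ W}
    (hSinv : ∀ (f : SiteL2K ℂ d (towerP L m (n + 1)) c₀ W) (x : TSite d (towerP L m (n + 1))),
      WL2.equiv ℂ (fun _ : TSite d (towerP L m (n + 1)) => c₀) W (Sinv f) x =
        Complex.exp (-(κ * (χ x : ℂ))) • WL2.equiv ℂ (fun _ : TSite d (towerP L m (n + 1)) => c₀) W f x)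
    {SG : SiteL2K ℂ d m c₁ W →ₗ[ℂ] SiteL2K ℂ d m c₁ W}
    (hSG : ∀ (g : SiteL2K ℂ d m c₁ W) (y : TSite d m),
      WL2.equiv ℂ (fun _ : TSite d m => c₁) W (SG g) y = Complex.exp (κ * (χ' y : ℂ)) • WL2.equiv ℂ (fun _ : TSite d m => c₁) W g y)
    (f : SiteL2K ℂ d (towerP L m (n + 1)) c₀ W) :
    ‖(SG ∘ₗ ((WL2.linearEquiv ℂ ℂ (fun _ : TSite d m => c₁)).symm.toLinearMap ∘ₗ QprimeTowerW L m n φ V (c₀ := c₀)) ∘ₗ Sinv) f -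
        (SG ∘ₗ ((WL2.linearEquiv ℂ ℂ (fun _ : TSite d m => c₁)).symm.toLinearMap ∘ₗ QprimeTowerW L m n φ U (c₀ := c₀)) ∘ₗ Sinv) f‖ ≤
      Real.exp (‖κ‖ * ℓ') * δQ * ‖f‖ := by
  -- the common phase-multiplied vector `u = τ·f`
  let u : SiteL2K ℂ d (towerP L m (n + 1)) c₀ W :=
    (WL2.equiv ℂ (fun _ : TSite d (towerP L m (n + 1)) => c₀) W).symm fun x =>
      (Complex.exp (κ * (χ' (blockCoord (L ^ (n + 1)) m (siteCast (towerP_eq_fineP_pow L m (n + 1)) x)) : ℂ)) *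
        Complex.exp (-(κ * (χ x : ℂ)))) • WL2.equiv ℂ (fun _ : TSite d (towerP L m (n + 1)) => c₀) W f x
  have hu : ∀ x : TSite d (towerP L m (n + 1)), WL2.equiv ℂ (fun _ : TSite d (towerP L m (n + 1)) => c₀) W u x =
      (Complex.exp (κ * (χ' (blockCoord (L ^ (n + 1)) m (siteCast (towerP_eq_fineP_pow L m (n + 1)) x)) : ℂ)) *
        Complex.exp (-(κ * (χ x : ℂ)))) • WL2.equiv ℂ (fun _ : TSite d (towerP L m (n + 1)) => c₀) W f x := fun x => by
    simp only [u, Equiv.apply_symm_apply]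
  rw [conj_QtildeTower_apply_eq hSinv hSG V hu, conj_QtildeTower_apply_eq hSinv hSG U hu]
  calc _ ≤ δQ * ‖u‖ := hLip u
    _ ≤ δQ * (Real.exp (‖κ‖ * ℓ') * ‖f‖) := mul_le_mul_of_nonneg_left (norm_phaseVec_le hχ' hu) hδQ
    _ = Real.exp (‖κ‖ * ℓ') * δQ * ‖f‖ := by ring

/-- **… AT `−κ̄` THROUGH THE ADJOINTS' POINTWISE ACTION**: `‖(S_G⁻¹)† Q̃′_k(V) S† f − (S_G⁻¹)† Q̃′_k(U) S† f‖ ≤ e^{‖κ‖ℓ′}·δ_{Q′}·‖f‖` for `S`, `S_G⁻¹`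
acting as `e^{κχ}`, `e^{−κχ′}` (`B9Eq311PointwiseMultipliers.equiv_adjoint_of_pointwise`; `‖−κ̄‖ = ‖κ‖`). [folklore]
[cite: Balaban1985BackgroundPropagators, (3.19) p.393, (3.49) p.399, (3.101) p.414] -/
theorem norm_QmTower_sub_QmTower_le
    (hχ' : ∀ (y : TSite d m) (x : TSite d (towerP L m (n + 1))),
      blockCoord (L ^ (n + 1)) m (siteCast (towerP_eq_fineP_pow L m (n + 1)) x) = y → |χ' y - χ x| ≤ ℓ')
    {δQ : ℝ} (hδQ : 0 ≤ δQ)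
    (hLip : ∀ s, ‖((WL2.linearEquiv ℂ ℂ (fun _ : TSite d m => c₁)).symm.toLinearMap ∘ₗ QprimeTowerW L m n φ V (c₀ := c₀)) s -
      ((WL2.linearEquiv ℂ ℂ (fun _ : TSite d m => c₁)).symm.toLinearMap ∘ₗ QprimeTowerW L m n φ U (c₀ := c₀)) s‖ ≤ δQ * ‖s‖)
    {S : SiteL2K ℂ d (towerP L m (n + 1)) c₀ W →ₗ[ℂ] SiteL2K ℂ d (towerP L m (n + 1)) c₀ W}
    (hS : ∀ (f : SiteL2K ℂ d (towerP L m (n + 1)) c₀ W) (x : TSite d (towerP L m (n + 1))),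
      WL2.equiv ℂ (fun _ : TSite d (towerP L m (n + 1)) => c₀) W (S f) x =
        Complex.exp (κ * (χ x : ℂ)) • WL2.equiv ℂ (fun _ : TSite d (towerP L m (n + 1)) => c₀) W f x)
    {SGinv : SiteL2K ℂ d m c₁ W →ₗ[ℂ] SiteL2K ℂ d m c₁ W}
    (hSGinv : ∀ (g : SiteL2K ℂ d m c₁ W) (y : TSite d m),
      WL2.equiv ℂ (fun _ : TSite d m => c₁) W (SGinv g) y = Complex.exp (-(κ * (χ' y : ℂ))) • WL2.equiv ℂ (fun _ : TSite d m => c₁) W g y)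
    (f : SiteL2K ℂ d (towerP L m (n + 1)) c₀ W) :
    ‖(LinearMap.adjoint SGinv ∘ₗ ((WL2.linearEquiv ℂ ℂ (fun _ : TSite d m => c₁)).symm.toLinearMap ∘ₗ QprimeTowerW L m n φ V (c₀ := c₀)) ∘ₗ
          LinearMap.adjoint S) f -
        (LinearMap.adjoint SGinv ∘ₗ ((WL2.linearEquiv ℂ ℂ (fun _ : TSite d m => c₁)).symm.toLinearMap ∘ₗ QprimeTowerW L m n φ U (c₀ := c₀)) ∘ₗ
          LinearMap.adjoint S) f‖ ≤
      Real.exp (‖κ‖ * ℓ') * δQ * ‖f‖ := by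
  have hA : ∀ (g : SiteL2K ℂ d m c₁ W) (y : TSite d m),
      WL2.equiv ℂ (fun _ : TSite d m => c₁) W (LinearMap.adjoint SGinv g) y =
        Complex.exp (-conj κ * (χ' y : ℂ)) • WL2.equiv ℂ (fun _ : TSite d m => c₁) W g y := by
    intro g y
    rw [B9Eq311PointwiseMultipliers.equiv_adjoint_of_pointwise SGinv _ hSGinv, ← Complex.exp_conj, map_neg, map_mul, Complex.conj_ofReal,
      neg_mul]
  have hB : ∀ (f : SiteL2K ℂ d (towerP L m (n + 1)) c₀ W) (x : TSite d (towerP L m (n + 1))),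
      WL2.equiv ℂ (fun _ : TSite d (towerP L m (n + 1)) => c₀) W (LinearMap.adjoint S f) x =
        Complex.exp (-(-conj κ * (χ x : ℂ))) • WL2.equiv ℂ (fun _ : TSite d (towerP L m (n + 1)) => c₀) W f x := by
    intro f x
    rw [B9Eq311PointwiseMultipliers.equiv_adjoint_of_pointwise S _ hS, ← Complex.exp_conj, map_mul, Complex.conj_ofReal, neg_mul, neg_neg]
  have h := norm_QpTower_sub_QpTower_le (φ := φ) (U := U) (V := V) (c₁ := c₁) (κ := -conj κ) hχ' hδQ hLip hB hA f
  rwa [norm_neg, Complex.norm_conj] at h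

/-- **THE ADJOINT READING** `‖S Q̃′_k(V)† S_G⁻¹ g − S Q̃′_k(U)† S_G⁻¹ g‖ ≤ e^{‖κ‖ℓ′}·δ_{Q′}·‖g‖` (a bound passes through the pairing,
`B9Eq324ConjugatedFormDifference.norm_le_of_inner_eq_inner`, from `norm_QmTower_sub_QmTower_le`). [folklore]
[cite: Balaban1985BackgroundPropagators, (3.19) p.393, (3.49) p.399, (3.101) p.414] -/
theorem norm_QpTower'_sub_QpTower'_le
    (hχ' : ∀ (y : TSite d m) (x : TSite d (towerP L m (n + 1))),
      blockCoord (L ^ (n + 1)) m (siteCast (towerP_eq_fineP_pow L m (n + 1)) x) = y → |χ' y - χ x| ≤ ℓ')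
    {δQ : ℝ} (hδQ : 0 ≤ δQ)
    (hLip : ∀ s, ‖((WL2.linearEquiv ℂ ℂ (fun _ : TSite d m => c₁)).symm.toLinearMap ∘ₗ QprimeTowerW L m n φ V (c₀ := c₀)) s -
      ((WL2.linearEquiv ℂ ℂ (fun _ : TSite d m => c₁)).symm.toLinearMap ∘ₗ QprimeTowerW L m n φ U (c₀ := c₀)) s‖ ≤ δQ * ‖s‖)
    {S : SiteL2K ℂ d (towerP L m (n + 1)) c₀ W →ₗ[ℂ] SiteL2K ℂ d (towerP L m (n + 1)) c₀ W}
    (hS : ∀ (f : SiteL2K ℂ d (towerP L m (n + 1)) c₀ W) (x : TSite d (towerP L m (n + 1))),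
      WL2.equiv ℂ (fun _ : TSite d (towerP L m (n + 1)) => c₀) W (S f) x =
        Complex.exp (κ * (χ x : ℂ)) • WL2.equiv ℂ (fun _ : TSite d (towerP L m (n + 1)) => c₀) W f x)
    {SGinv : SiteL2K ℂ d m c₁ W →ₗ[ℂ] SiteL2K ℂ d m c₁ W}
    (hSGinv : ∀ (g : SiteL2K ℂ d m c₁ W) (y : TSite d m),
      WL2.equiv ℂ (fun _ : TSite d m => c₁) W (SGinv g) y = Complex.exp (-(κ * (χ' y : ℂ))) • WL2.equiv ℂ (fun _ : TSite d m => c₁) W g y)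
    (g : SiteL2K ℂ d m c₁ W) :
    ‖(S ∘ₗ LinearMap.adjoint ((WL2.linearEquiv ℂ ℂ (fun _ : TSite d m => c₁)).symm.toLinearMap ∘ₗ QprimeTowerW L m n φ V (c₀ := c₀)) ∘ₗ
          SGinv) g -
        (S ∘ₗ LinearMap.adjoint ((WL2.linearEquiv ℂ ℂ (fun _ : TSite d m => c₁)).symm.toLinearMap ∘ₗ QprimeTowerW L m n φ U (c₀ := c₀)) ∘ₗ
          SGinv) g‖ ≤
      Real.exp (‖κ‖ * ℓ') * δQ * ‖g‖ := by
  refine B9Eq324ConjugatedFormDifference.norm_le_of_inner_eq_inner (𝕜 := ℂ)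
    (K := fun g => (S ∘ₗ LinearMap.adjoint ((WL2.linearEquiv ℂ ℂ (fun _ : TSite d m => c₁)).symm.toLinearMap ∘ₗ
        QprimeTowerW L m n φ V (c₀ := c₀)) ∘ₗ SGinv) g -
      (S ∘ₗ LinearMap.adjoint ((WL2.linearEquiv ℂ ℂ (fun _ : TSite d m => c₁)).symm.toLinearMap ∘ₗ
        QprimeTowerW L m n φ U (c₀ := c₀)) ∘ₗ SGinv) g)
    (L := fun f => (LinearMap.adjoint SGinv ∘ₗ ((WL2.linearEquiv ℂ ℂ (fun _ : TSite d m => c₁)).symm.toLinearMap ∘ₗ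
        QprimeTowerW L m n φ V (c₀ := c₀)) ∘ₗ LinearMap.adjoint S) f -
      (LinearMap.adjoint SGinv ∘ₗ ((WL2.linearEquiv ℂ ℂ (fun _ : TSite d m => c₁)).symm.toLinearMap ∘ₗ
        QprimeTowerW L m n φ U (c₀ := c₀)) ∘ₗ LinearMap.adjoint S) f)
    (by positivity) (fun g f => ?_) (fun f => norm_QmTower_sub_QmTower_le (φ := φ) (c₁ := c₁) hχ' hδQ hLip hS hSGinv f) g
  simp only [LinearMap.comp_apply, inner_sub_left, inner_sub_right, LinearMap.adjoint_inner_left, ← LinearMap.adjoint_inner_right S,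
    ← LinearMap.adjoint_inner_right SGinv]

end Letters

/-! ## §2 The letter `δ_{Q′}` discharged on the chain's carrier by ne9-leaf-02's `ℓ²` tower letter -/

section Levels

variable {d : ℕ} {L : ℕ} [NeZero L] {m : Fin d → ℕ} [∀ i, NeZero (m i)] {n : ℕ}
  {𝔸 : Type*} [NormedRing 𝔸] [NormedAlgebra ℂ 𝔸] [CompleteSpace 𝔸] [NormOneClass 𝔸]
  {W : Type*} [NormedAddCommGroup W] [InnerProductSpace ℂ W] [FiniteDimensional ℂ W] (φ : W ≃ₗ[ℂ] 𝔸) {Mφ Mφ' : ℝ}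
  (hMφ : 0 ≤ Mφ) (hMφ' : 0 ≤ Mφ') (hφ : ∀ w, ‖φ w‖ ≤ Mφ * ‖w‖) (hφ' : ∀ X, ‖φ.symm X‖ ≤ Mφ' * ‖X‖)
  {c₀ : ℝ} [Fact (0 < c₀)] {c₁ : ℝ} [Fact (0 < c₁)]
  (U V : Bond d (towerP L m (n + 1)) → 𝔸ˣ) (εU δUV : ℕ → ℝ) (hεU : ∀ j, 0 ≤ εU j) (hδUV : ∀ j, 0 ≤ δUV j)
  (hUε : ∀ (j : ℕ) (b : Bond d (towerP L m (j + 1))), ‖(UlevOf L m (n + 1) U j b : 𝔸) - 1‖ ≤ εU j)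
  (hVε : ∀ (j : ℕ) (b : Bond d (towerP L m (j + 1))), ‖(UlevOf L m (n + 1) V j b : 𝔸) - 1‖ ≤ εU j)
  (hUb : ∀ (j : ℕ) (b : Bond d (towerP L m (j + 1))), UlevOf L m (n + 1) U j b ∈ U1 𝔸)
  (hVb : ∀ (j : ℕ) (b : Bond d (towerP L m (j + 1))), UlevOf L m (n + 1) V j b ∈ U1 𝔸)
  (hUV : ∀ (j : ℕ) (b : Bond d (towerP L m (j + 1))), ‖(UlevOf L m (n + 1) U j b : 𝔸) - (UlevOf L m (n + 1) V j b : 𝔸)‖ ≤ δUV j)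
  {κ : ℂ} {ℓ' : ℝ} {χ : TSite d (towerP L m (n + 1)) → ℝ} {χ' : TSite d m → ℝ}

omit [FiniteDimensional ℂ W] in
include hφ hφ' hMφ hMφ' hεU hδUV hUε hVε hUb hVb hUV in
/-- ne9-leaf-02's chain letter read as the displayed `δ_{Q′}` of §1 (order `V − U`, constant `≥ 0`). [folklore]
[cite: Balaban1985BackgroundPropagators, (3.19) p.393, (3.11) p.392, (3.65) p.403] -/
theorem deltaQprime_of_levels :
    0 ≤ (∏ j ∈ Finset.range (n + 1), (1 + 2 * Mφ * Mφ' * εU j) ^ (d * (L - 1))) *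
        ((∏ j ∈ Finset.range (n + 1), (1 + (d * (L - 1) : ℕ) * (2 * Mφ * Mφ' * δUV j) * (1 + 2 * Mφ * Mφ' * εU j) ^ (d * (L - 1)))) - 1) *
        Real.sqrt (c₁ / (c₀ * ((L : ℝ) ^ (n + 1)) ^ d)) ∧
    ∀ s : SiteL2K ℂ d (towerP L m (n + 1)) c₀ W,
      ‖((WL2.linearEquiv ℂ ℂ (fun _ : TSite d m => c₁)).symm.toLinearMap ∘ₗ QprimeTowerW L m n φ V (c₀ := c₀)) s -
          ((WL2.linearEquiv ℂ ℂ (fun _ : TSite d m => c₁)).symm.toLinearMap ∘ₗ QprimeTowerW L m n φ U (c₀ := c₀)) s‖ ≤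
        (∏ j ∈ Finset.range (n + 1), (1 + 2 * Mφ * Mφ' * εU j) ^ (d * (L - 1))) *
          ((∏ j ∈ Finset.range (n + 1), (1 + (d * (L - 1) : ℕ) * (2 * Mφ * Mφ' * δUV j) * (1 + 2 * Mφ * Mφ' * εU j) ^ (d * (L - 1)))) - 1) *
          Real.sqrt (c₁ / (c₀ * ((L : ℝ) ^ (n + 1)) ^ d)) * ‖s‖ := by
  refine ⟨?_, fun s => ?_⟩
  · have hε : ∀ j, 0 ≤ 2 * Mφ * Mφ' * εU j := fun j => by have := hεU j; positivity
    have hP : 0 ≤ ∏ j ∈ Finset.range (n + 1), (1 + 2 * Mφ * Mφ' * εU j) ^ (d * (L - 1)) :=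
      Finset.prod_nonneg fun j _ => pow_nonneg (by linarith [hε j]) _
    have hT : 0 ≤ (∏ j ∈ Finset.range (n + 1),
        (1 + (d * (L - 1) : ℕ) * (2 * Mφ * Mφ' * δUV j) * (1 + 2 * Mφ * Mφ' * εU j) ^ (d * (L - 1)))) - 1 :=
      sub_nonneg.2 (Finset.one_le_prod fun j _ => by
        have h1 : 0 ≤ (d * (L - 1) : ℕ) * (2 * Mφ * Mφ' * δUV j) * (1 + 2 * Mφ * Mφ' * εU j) ^ (d * (L - 1)) := by
          have := hδUV j; have := hε j; positivity
        linarith)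
    positivity
  · rw [norm_sub_rev]
    exact norm_QtildeTower_sub_QtildeTower_le L m n φ hMφ hMφ' hφ hφ' (c₀ := c₀) c₁ U V εU δUV hεU hδUV hUε hVε hUb hVb hUV s

omit [FiniteDimensional ℂ W] in
include hφ hφ' hMφ hMφ' hεU hδUV hUε hVε hUb hVb hUV in
/-- **§1 AT `κ` WITH `δ_{Q′}` DISCHARGED**: the level averages `Ū^j`, `V̄^j` `U1`-valued, `ε_j`-small and `δ_j`-close ⟹
`‖S_G Q̃′_k(V) S⁻¹ f − S_G Q̃′_k(U) S⁻¹ f‖ ≤ e^{‖κ‖ℓ′}·P_ε·(T_{ε,δ} − 1)·√(c₁∕(c₀L^{(n+1)d}))·‖f‖`. [folklore]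
[cite: Balaban1985BackgroundPropagators, (3.19) p.393, (3.11) p.392, (3.49) p.399, (3.65) p.403, (3.101) p.414] -/
theorem norm_QpTower_sub_QpTower_le_of_levels
    (hχ' : ∀ (y : TSite d m) (x : TSite d (towerP L m (n + 1))),
      blockCoord (L ^ (n + 1)) m (siteCast (towerP_eq_fineP_pow L m (n + 1)) x) = y → |χ' y - χ x| ≤ ℓ')
    {Sinv : SiteL2K ℂ d (towerP L m (n + 1)) c₀ W →ₗ[ℂ] SiteL2K ℂ d (towerP L m (n + 1)) c₀ W}
    (hSinv : ∀ (f : SiteL2K ℂ d (towerP L m (n + 1)) c₀ W) (x : TSite d (towerP L m (n + 1))),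
      WL2.equiv ℂ (fun _ : TSite d (towerP L m (n + 1)) => c₀) W (Sinv f) x =
        Complex.exp (-(κ * (χ x : ℂ))) • WL2.equiv ℂ (fun _ : TSite d (towerP L m (n + 1)) => c₀) W f x)
    {SG : SiteL2K ℂ d m c₁ W →ₗ[ℂ] SiteL2K ℂ d m c₁ W}
    (hSG : ∀ (g : SiteL2K ℂ d m c₁ W) (y : TSite d m),
      WL2.equiv ℂ (fun _ : TSite d m => c₁) W (SG g) y = Complex.exp (κ * (χ' y : ℂ)) • WL2.equiv ℂ (fun _ : TSite d m => c₁) W g y)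
    (f : SiteL2K ℂ d (towerP L m (n + 1)) c₀ W) :
    ‖(SG ∘ₗ ((WL2.linearEquiv ℂ ℂ (fun _ : TSite d m => c₁)).symm.toLinearMap ∘ₗ QprimeTowerW L m n φ V (c₀ := c₀)) ∘ₗ Sinv) f -
        (SG ∘ₗ ((WL2.linearEquiv ℂ ℂ (fun _ : TSite d m => c₁)).symm.toLinearMap ∘ₗ QprimeTowerW L m n φ U (c₀ := c₀)) ∘ₗ Sinv) f‖ ≤
      Real.exp (‖κ‖ * ℓ') * ((∏ j ∈ Finset.range (n + 1), (1 + 2 * Mφ * Mφ' * εU j) ^ (d * (L - 1))) *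
        ((∏ j ∈ Finset.range (n + 1), (1 + (d * (L - 1) : ℕ) * (2 * Mφ * Mφ' * δUV j) * (1 + 2 * Mφ * Mφ' * εU j) ^ (d * (L - 1)))) - 1) *
        Real.sqrt (c₁ / (c₀ * ((L : ℝ) ^ (n + 1)) ^ d))) * ‖f‖ := by
  obtain ⟨h0, hLip⟩ := deltaQprime_of_levels (L := L) (m := m) (n := n) φ hMφ hMφ' hφ hφ' (c₀ := c₀) (c₁ := c₁) U V εU δUV hεU hδUV
    hUε hVε hUb hVb hUV
  exact norm_QpTower_sub_QpTower_le hχ' h0 hLip hSinv hSG f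

include hφ hφ' hMφ hMφ' hεU hδUV hUε hVε hUb hVb hUV in
/-- **§1 AT `−κ̄` WITH `δ_{Q′}` DISCHARGED.** [folklore] [cite: Balaban1985BackgroundPropagators, (3.19) p.393, (3.11) p.392, (3.49) p.399, (3.65) p.403, (3.101) p.414] -/
theorem norm_QmTower_sub_QmTower_le_of_levels
    (hχ' : ∀ (y : TSite d m) (x : TSite d (towerP L m (n + 1))),
      blockCoord (L ^ (n + 1)) m (siteCast (towerP_eq_fineP_pow L m (n + 1)) x) = y → |χ' y - χ x| ≤ ℓ')
    {S : SiteL2K ℂ d (towerP L m (n + 1)) c₀ W →ₗ[ℂ] SiteL2K ℂ d (towerP L m (n + 1)) c₀ W}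
    (hS : ∀ (f : SiteL2K ℂ d (towerP L m (n + 1)) c₀ W) (x : TSite d (towerP L m (n + 1))),
      WL2.equiv ℂ (fun _ : TSite d (towerP L m (n + 1)) => c₀) W (S f) x =
        Complex.exp (κ * (χ x : ℂ)) • WL2.equiv ℂ (fun _ : TSite d (towerP L m (n + 1)) => c₀) W f x)
    {SGinv : SiteL2K ℂ d m c₁ W →ₗ[ℂ] SiteL2K ℂ d m c₁ W}
    (hSGinv : ∀ (g : SiteL2K ℂ d m c₁ W) (y : TSite d m),
      WL2.equiv ℂ (fun _ : TSite d m => c₁) W (SGinv g) y = Complex.exp (-(κ * (χ' y : ℂ))) • WL2.equiv ℂ (fun _ : TSite d m => c₁) W g y)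
    (f : SiteL2K ℂ d (towerP L m (n + 1)) c₀ W) :
    ‖(LinearMap.adjoint SGinv ∘ₗ ((WL2.linearEquiv ℂ ℂ (fun _ : TSite d m => c₁)).symm.toLinearMap ∘ₗ QprimeTowerW L m n φ V (c₀ := c₀)) ∘ₗ
          LinearMap.adjoint S) f -
        (LinearMap.adjoint SGinv ∘ₗ ((WL2.linearEquiv ℂ ℂ (fun _ : TSite d m => c₁)).symm.toLinearMap ∘ₗ QprimeTowerW L m n φ U (c₀ := c₀)) ∘ₗ
          LinearMap.adjoint S) f‖ ≤
      Real.exp (‖κ‖ * ℓ') * ((∏ j ∈ Finset.range (n + 1), (1 + 2 * Mφ * Mφ' * εU j) ^ (d * (L - 1))) *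
        ((∏ j ∈ Finset.range (n + 1), (1 + (d * (L - 1) : ℕ) * (2 * Mφ * Mφ' * δUV j) * (1 + 2 * Mφ * Mφ' * εU j) ^ (d * (L - 1)))) - 1) *
        Real.sqrt (c₁ / (c₀ * ((L : ℝ) ^ (n + 1)) ^ d))) * ‖f‖ := by
  obtain ⟨h0, hLip⟩ := deltaQprime_of_levels (L := L) (m := m) (n := n) φ hMφ hMφ' hφ hφ' (c₀ := c₀) (c₁ := c₁) U V εU δUV hεU hδUV
    hUε hVε hUb hVb hUV
  exact norm_QmTower_sub_QmTower_le hχ' h0 hLip hS hSGinv f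

include hφ hφ' hMφ hMφ' hεU hδUV hUε hVε hUb hVb hUV in
/-- **§1's ADJOINT READING WITH `δ_{Q′}` DISCHARGED.** [folklore] [cite: Balaban1985BackgroundPropagators, (3.19) p.393, (3.11) p.392, (3.49) p.399, (3.65) p.403, (3.101) p.414] -/
theorem norm_QpTower'_sub_QpTower'_le_of_levels
    (hχ' : ∀ (y : TSite d m) (x : TSite d (towerP L m (n + 1))),
      blockCoord (L ^ (n + 1)) m (siteCast (towerP_eq_fineP_pow L m (n + 1)) x) = y → |χ' y - χ x| ≤ ℓ')
    {S : SiteL2K ℂ d (towerP L m (n + 1)) c₀ W →ₗ[ℂ] SiteL2K ℂ d (towerP L m (n + 1)) c₀ W}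
    (hS : ∀ (f : SiteL2K ℂ d (towerP L m (n + 1)) c₀ W) (x : TSite d (towerP L m (n + 1))),
      WL2.equiv ℂ (fun _ : TSite d (towerP L m (n + 1)) => c₀) W (S f) x =
        Complex.exp (κ * (χ x : ℂ)) • WL2.equiv ℂ (fun _ : TSite d (towerP L m (n + 1)) => c₀) W f x)
    {SGinv : SiteL2K ℂ d m c₁ W →ₗ[ℂ] SiteL2K ℂ d m c₁ W}
    (hSGinv : ∀ (g : SiteL2K ℂ d m c₁ W) (y : TSite d m),
      WL2.equiv ℂ (fun _ : TSite d m => c₁) W (SGinv g) y = Complex.exp (-(κ * (χ' y : ℂ))) • WL2.equiv ℂ (fun _ : TSite d m => c₁) W g y)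
    (g : SiteL2K ℂ d m c₁ W) :
    ‖(S ∘ₗ LinearMap.adjoint ((WL2.linearEquiv ℂ ℂ (fun _ : TSite d m => c₁)).symm.toLinearMap ∘ₗ QprimeTowerW L m n φ V (c₀ := c₀)) ∘ₗ
          SGinv) g -
        (S ∘ₗ LinearMap.adjoint ((WL2.linearEquiv ℂ ℂ (fun _ : TSite d m => c₁)).symm.toLinearMap ∘ₗ QprimeTowerW L m n φ U (c₀ := c₀)) ∘ₗ
          SGinv) g‖ ≤
      Real.exp (‖κ‖ * ℓ') * ((∏ j ∈ Finset.range (n + 1), (1 + 2 * Mφ * Mφ' * εU j) ^ (d * (L - 1))) *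
        ((∏ j ∈ Finset.range (n + 1), (1 + (d * (L - 1) : ℕ) * (2 * Mφ * Mφ' * δUV j) * (1 + 2 * Mφ * Mφ' * εU j) ^ (d * (L - 1)))) - 1) *
        Real.sqrt (c₁ / (c₀ * ((L : ℝ) ^ (n + 1)) ^ d))) * ‖g‖ := by
  obtain ⟨h0, hLip⟩ := deltaQprime_of_levels (L := L) (m := m) (n := n) φ hMφ hMφ' hφ hφ' (c₀ := c₀) (c₁ := c₁) U V εU δUV hεU hδUV
    hUε hVε hUb hVb hUV
  exact norm_QpTower'_sub_QpTower'_le hχ' h0 hLip hS hSGinv g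

end Levels

end Literature.MathematicalPhysics.QuantumFieldTheory.Balaban1983to89.B9Eq349ConjugatedQprimeTowerTwoBackgrounds

end
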